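import Literature.ModelTheory.ExponentialFields.OMinimalDifferentiable
import Literature.ModelTheory.ExponentialFields.OMinimalCurveSelection
import HarnessLib

/-!
# Definable curves are `C¹` off a finite set; `C¹` curve selection (van den Dries, Ch. 6, (1.5) with Ch. 7, (2.5))

Topic `Literature/ModelTheory/ExponentialFields`.  In an o-minimal expansion of an ordered
field, L. van den Dries, *Tame topology and o-minimal structures* (1998), Ch. 7, (2.5) ("if
`f : I → R` is definable, then `f` is differentiable at all but finitely many points of `I`",
with continuous derivative off finitely many more points — `(II₁)` of (3.2)) applied
coordinatewise to a definable curve `γ : M → Mⁿ⁺¹` shows that `γ` is `C¹` off a finite set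
(`exists_finset_forall_hasFieldDerivAt_coord`); combined with curve selection, Ch. 6, (1.5)
(`OMinimalCurveSelection.lean`), the selected curve can be taken `C¹` on `(0, ε)`
(`curveSelection_hasFieldDerivAt`: after shrinking `ε` below the finitely many bad parameters).
This is the form in which curves are used in one-variable arguments along definable curves
(the tree's chain rule `HasLinDerivAt.comp_curve`, `DefinablyCompleteChainRule.lean`).

Nothing here is a named fact; no definition is introduced.

## References

* [Dries1998] L. van den Dries, *Tame topology and o-minimal structures*, London Math. Soc.
  Lecture Note Ser. 248, CUP 1998, Ch. 6, (1.5), p. 94; Ch. 7, (2.5), (3.2) `(II₁)`.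
-/

open Set FirstOrder FirstOrder.Language Function
open _root_.Filter _root_.Topology

namespace Literature.ModelTheory.ExponentialFields

section OMinimal

variable {L : FirstOrder.Language.{0, 0}} {M : Type*} [L.Structure M] [Field M] [LinearOrder M]
  [IsStrictOrderedRing M] (φ : Language.orderedRing →ᴸ L) [φ.IsExpansionOn M]
  [TopologicalSpace M] [OrderTopology M]

include φ

/-- **Definable curves are `C¹` off a finite set** (van den Dries 1998, Ch. 7, (2.5) and
(3.2) `(II₁)`, coordinatewise): for a curve `γ : M → Mⁿ` with definable coordinate functions
there are a finite set `F` and a curve `γ'` with definable coordinates such that, at every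
`t ∉ F`, each coordinate of `γ` has derivative the corresponding coordinate of `γ'(t)` and the
coordinates of `γ'` are continuous at `t`. [cite: Dries1998, Ch. 7 (2.5)] -/
theorem exists_finset_forall_hasFieldDerivAt_coord (hO : L.IsOMinimal M) {n : ℕ}
    {γ : M → Fin n → M}
    (hγ : ∀ i, (univ : Set M).Definable L {v : Fin 2 → M | v 1 = γ (v 0) i}) :
    ∃ (F : Finset M) (γ' : M → Fin n → M),
      (∀ i, (univ : Set M).Definable L {v : Fin 2 → M | v 1 = γ' (v 0) i}) ∧
      ∀ t, t ∉ F → ∀ i, HasFieldDerivAt (fun s => γ s i) (γ' t i) t ∧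
        ContinuousAt (fun s => γ' s i) t := by
  classical
  have h : ∀ i, ∃ (F : Finset M) (g : M → M),
      (univ : Set M).Definable L {v : Fin 2 → M | v 1 = g (v 0)} ∧
      ∀ t, t ∉ F → HasFieldDerivAt (fun s => γ s i) (g t) t ∧ ContinuousAt g t := fun i =>
    exists_finset_hasFieldDerivAt_continuousAt φ hO (f := fun s => γ s i) (hγ i)
  choose F g hgdef hg using h
  refine ⟨Finset.univ.biUnion F, fun t i => g i t, fun i => hgdef i, fun t ht i => ?_⟩
  have hti : t ∉ F i := fun h => ht (Finset.mem_biUnion.2 ⟨i, Finset.mem_univ _, h⟩)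
  exact hg i t hti

variable {A : Set M}

/-- **`C¹` curve selection** (van den Dries 1998, Ch. 6, (1.5), sharpened by Ch. 7, (2.5)): for
`X ⊆ Mⁿ⁺¹` definable over `A` and `a ∈ cl(X) ∖ X` there are `ε > 0` and a curve `γ`,
definable over `A ∪ {a₀, …, aₙ}`, continuous and injective on `(0, ε)`, with `γ(t) ∈ X`,
`|a - γ(t)| = t`, `γ(t) → a` as `t → 0⁺`, and moreover **`C¹` on `(0, ε)`**: its coordinates
have derivatives `γ'(t)` there, `γ'` with definable coordinates continuous on `(0, ε)`.
[cite: Dries1998, Ch. 6 (1.5)] -/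
theorem curveSelection_hasFieldDerivAt (hO : L.IsOMinimal M) {n : ℕ} {X : Set (Fin (n + 1) → M)}
    (hX : A.Definable L X) {a : Fin (n + 1) → M} (ha : a ∈ closure X) (haX : a ∉ X) :
    ∃ ε : M, 0 < ε ∧ ∃ γ γ' : M → Fin (n + 1) → M,
      (A ∪ range a).DefinableMap L (fun v : Fin 1 → M => γ (v 0)) ∧
      ContinuousOn γ (Ioo 0 ε) ∧ InjOn γ (Ioo 0 ε) ∧
      (∀ t ∈ Ioo 0 ε, γ t ∈ X ∧ CurveSelection.supDist a (γ t) = t) ∧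
      Tendsto γ (𝓝[>] 0) (𝓝 a) ∧
      (∀ i, (univ : Set M).Definable L {v : Fin 2 → M | v 1 = γ' (v 0) i}) ∧
      (∀ t ∈ Ioo 0 ε, ∀ i, HasFieldDerivAt (fun s => γ s i) (γ' t i) t) ∧
      ∀ i, ContinuousOn (fun t => γ' t i) (Ioo 0 ε) := by
  classical
  obtain ⟨ε, hε, γ, hγdef, hγc, hγinj, hγX, hγlim⟩ :=
    CurveSelection.curveSelection φ hO hX ha haX
  -- the coordinates of `γ` have graphs definable with parameters
  have hγi : ∀ i, (univ : Set M).Definable L {v : Fin 2 → M | v 1 = γ (v 0) i} := fun i =>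
    definable_graph_of_definableFun (g := fun t => γ t i)
      (((hγdef i).mono (subset_univ _)).comp fun _ => definableFun_proj 0)
  obtain ⟨F, γ', hγ'def, hF⟩ := exists_finset_forall_hasFieldDerivAt_coord φ hO hγi
  -- shrink `ε` below the bad parameters
  obtain ⟨c, hc, hcF⟩ := exists_gt_forall_notMem_Ioo F (0 : M)
  refine ⟨min ε c, lt_min hε hc, γ, γ', hγdef, hγc.mono (Ioo_subset_Ioo_right (min_le_left _ _)),
    hγinj.mono (Ioo_subset_Ioo_right (min_le_left _ _)),
    fun t ht => hγX t ⟨ht.1, ht.2.trans_le (min_le_left _ _)⟩, hγlim, hγ'def, ?_, ?_⟩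
  · intro t ht i
    have htF : t ∉ F := fun h => hcF t h ⟨ht.1, ht.2.trans_le (min_le_right _ _)⟩
    exact (hF t htF i).1
  · intro i t ht
    have htF : t ∉ F := fun h => hcF t h ⟨ht.1, ht.2.trans_le (min_le_right _ _)⟩
    exact (hF t htF i).2.continuousWithinAt

end OMinimal

end Literature.ModelTheory.ExponentialFields
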